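import Literature.Analysis.FluidPDE.PerturbedNSFourierSynthesis
import Literature.Analysis.FluidPDE.NavierStokesCorrectorAntidivergence
import Literature.Analysis.FluidPDE.PassiveScalarWellPosednessProofs
import HarnessLib

/-!
# The synthesized field solves the perturbed Navier–Stokes system on `[0, θ] × T^d`

Analysis/FluidPDE proof file, sequel of `PerturbedNSFourierSynthesis`, last Fourier-side file
of the chain `PerturbedNSFourier*` (Majda–Bertozzi 2002, Thm. 3.4; Cheskidov–Luo 2022, §3.1
(3.2) for the system). Under the threshold hypotheses `BallHyp` for the data of a jointly
smooth divergence-free background `u` on `[0, θ] × T^d` and a smooth divergence-free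
mean-zero datum `v₀`, the real fields `v = vel ν θ u v₀`, `q = pres ν θ u v₀` solve the
**perturbed Navier–Stokes system** (the Cheskidov–Luo perturbation system with datum, zero
stress and viscosity `ν`)

  `∂ₜv + (v·∇)v + (u·∇)v + (v·∇)u = νΔv - ∇q` on `[0, θ]` (one-sided time derivative),
  `div v(t) = 0`, `∫ v(t) = 0 = ∫ q(t)`, `v(0) = v₀`,

with `v`, `q` jointly smooth on `[0, θ] × T^d` (`vel_isSolution`):

* **momentum** (`momentum_complex`): for each component `l` and `t ∈ [0, θ]` the complex
  defect `∂ₜVₗ + ∑ⱼ (Vⱼ∂ⱼVₗ + uⱼ∂ⱼVₗ + Vⱼ∂ⱼuₗ) + ∂ₗQ - νΔVₗ` is continuous with Fourier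
  coefficients `-(P G)ₗ + Gₗ + 2πikₗ q̂ = 0` (the dictionary of `PerturbedNSFourierSynthesis`,
  products ↦ lattice convolutions `ScalarFourier.mFourierCoeff_mul`, and
  `CorrectorFourier.projSym_pressure_identity` at zero stress), hence vanishes (uniqueness of
  Fourier coefficients, Grafakos 2014, Prop. 3.2.4); all fields being real this is the real
  componentwise identity, and the vector identity follows (`Torus.convect_apply_eq`,
  `Torus.timeDerivWithin_apply_comp`, `Torus.laplacian_apply_comp`);
* **incompressibility**: `∑ₗ ∂ₗVₗ` has coefficients `2πi ∑ₗ kₗ cₗ = 0`; **zero means**: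
  `𝓕(Vₗ)(0) = c(l,t,0) = 0`, `q̂(0) = 0`; **datum**: `vel ν θ u v₀ 0 = v₀` (synthesis file).

## References

* A. J. Majda, A. L. Bertozzi, *Vorticity and Incompressible Flow*, CUP 2002, Thm. 3.4. [`MajdaBertozziCUP2002`]
* A. Cheskidov, X. Luo, arXiv:2009.06596, §3.1 (3.2), Prop. 3.2. [`CheskidovLuo2022`]
* L. Grafakos, *Classical Fourier Analysis*, 3rd ed. (2014), Prop. 3.2.4, 3.2.6 (8), §3.3.1. [`Grafakos2014`]
-/

noncomputable section

open MeasureTheory Real Set Filter Topology UnitAddTorus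

namespace Literature.Analysis.FluidPDE

namespace PerturbedNSFourier

open scoped ComplexConjugate ContDiff
open ScalarFourier
open CorrectorFourier (leraySym projSym presCoef presCoef_apply convSym convSym_apply compC compC_apply
  driftCoeff driftCoeff_apply isSmoothSpaceTimeOn_compC projSym_pressure_identity sum_dsym_mul_eq_zero)
open LinearisedNSFourier (datumCoeff)
open FourierNS (HasDecay clamp)
open Literature.Analysis.FunctionSpaces.Torus (freqNormSq IsSmooth)

variable {d : Type*} [Fintype d] [DecidableEq d]
variable {ν θ : ℝ} {u : ℝ → UnitAddTorus d → EuclideanSpace ℝ d}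
  {v₀ : UnitAddTorus d → EuclideanSpace ℝ d} {Z ρ A : ℝ}

-- one long verification; the coefficient bookkeeping elaborates slowly
set_option maxHeartbeats 1600000 in
/-- **The complex momentum equation, componentwise.** For `t ∈ [0, θ]`, every component `l`
and point `x`:
`∂ₜVₗ + ∑ⱼ (Vⱼ∂ⱼVₗ + uⱼ ∂ⱼVₗ + Vⱼ ∂ⱼuₗ) + ∂ₗQ - νΔVₗ = 0` for the synthesized complex fields
`V = velC ν θ u v₀`, `Q = presC ν θ u v₀` (the continuous defect has vanishing Fourier
coefficients: `-νₖcₗ - (P G)ₗ + Gₗ + 2πikₗq̂ + 4π²ν|k|²cₗ = 0` by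
`CorrectorFourier.projSym_pressure_identity` at zero stress; Grafakos 2014, Prop. 3.2.4). [folklore] -/
theorem momentum_complex (h : BallHyp ν θ (driftCoeff θ u) (datumCoeff v₀) Z ρ A)
    (hu : FunctionSpaces.Torus.IsSmoothSpaceTimeOn (Icc 0 θ) u)
    (hdiv : ∀ t ∈ Icc 0 θ, FunctionSpaces.Torus.IsDivFree (u t)) (hv₀ : IsSmooth v₀)
    (hv₀div : FunctionSpaces.Torus.IsDivFree v₀) (hv₀mean : FunctionSpaces.Torus.HasZeroMean v₀)
    (l : d) {t : ℝ} (ht : t ∈ Icc 0 θ) (x : UnitAddTorus d) :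
    FunctionSpaces.Torus.timeDerivWithin (Icc 0 θ) (velC ν θ u v₀ l) t x +
      (∑ j, (velC ν θ u v₀ j t x * FunctionSpaces.Torus.partialDeriv j (velC ν θ u v₀ l t) x +
        compC u j t x * FunctionSpaces.Torus.partialDeriv j (velC ν θ u v₀ l t) x +
        velC ν θ u v₀ j t x * FunctionSpaces.Torus.partialDeriv j (compC u l t) x)) +
      FunctionSpaces.Torus.partialDeriv l (presC ν θ u v₀ t) x -
        (ν : ℂ) * FunctionSpaces.Torus.laplacian (velC ν θ u v₀ l t) x = 0 := by
  obtain ⟨-, hdecay, -, -, -, -, -, -⟩ := solCoeff_spec h hu hdiv hv₀ hv₀div hv₀mean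
  obtain ⟨hV, hQ, -, -, -, -, hcV, hcVt, hcQ, -, -⟩ := synth_spec h hu hdiv hv₀ hv₀div hv₀mean
  have hθ := h.hθ
  have hUS : UniqueDiffOn ℝ (Icc 0 θ) := uniqueDiffOn_Icc hθ
  -- notation
  set c := solCoeff ν θ u v₀ with hc
  set U := driftCoeff θ u with hU
  set V := velC ν θ u v₀ with hVdef
  set Qc := presC ν θ u v₀ with hQcdef
  -- smoothness of slices
  have hVt : ∀ l, IsSmooth (V l t) := fun l => (hV l).isSmooth_slice ht
  have hQt : IsSmooth (Qc t) := hQ.isSmooth_slice ht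
  have hcompC : ∀ j, FunctionSpaces.Torus.IsSmoothSpaceTimeOn (Icc 0 θ) (compC u j) :=
    isSmoothSpaceTimeOn_compC hu
  have hcompCt : ∀ j, IsSmooth (compC u j t) := fun j => (hcompC j).isSmooth_slice ht
  -- summability of coefficients
  obtain ⟨C₀, -, hC₀⟩ := hdecay (latOrder d)
  have hsumc : ∀ l, Summable fun k => ‖c l t k‖ := fun l => summable_norm_of_hasDecay le_rfl (hC₀ l t)
  -- the dictionary at `t`
  have hcU : ∀ j m, mFourierCoeff (compC u j t) m = U j t m := by
    intro j m; rw [hU, driftCoeff_apply, FourierNS.clamp_of_mem ht]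
  have hcVd : ∀ j l m, mFourierCoeff (FunctionSpaces.Torus.partialDeriv j (V l t)) m = dsym j m * c l t m := by
    intro j l m
    rw [FunctionSpaces.Torus.mFourierCoeff_partialDeriv (hVt l) j m, hcV, dsym_apply, smul_eq_mul]
  have hcVΔ : ∀ l m, mFourierCoeff (FunctionSpaces.Torus.laplacian (V l t)) m =
      -((4 * π ^ 2 * freqNormSq m : ℝ) : ℂ) * c l t m := by
    intro l m
    rw [mFourierCoeff_laplacian (hVt l), hcV]
  have hcUd : ∀ j l m,
      mFourierCoeff (FunctionSpaces.Torus.partialDeriv j (compC u l t)) m = dsym j m * U l t m := by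
    intro j l m
    rw [FunctionSpaces.Torus.mFourierCoeff_partialDeriv (hcompCt l) j m, hcU l, dsym_apply, smul_eq_mul]
  have hcQd : ∀ l m, mFourierCoeff (FunctionSpaces.Torus.partialDeriv l (Qc t)) m =
      dsym l m * presCoeffField ν θ u v₀ t m := by
    intro l m
    rw [FunctionSpaces.Torus.mFourierCoeff_partialDeriv hQt l m, hcQ t ht, dsym_apply, smul_eq_mul]
  -- products ↦ lattice convolutions
  have hsumV : ∀ j, Summable fun k => ‖mFourierCoeff (V j t) k‖ := by
    intro j; simp_rw [hcV]; exact hsumc j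
  have hP1 : ∀ j l m, mFourierCoeff (fun x => V j t x * FunctionSpaces.Torus.partialDeriv j (V l t) x) m =
      lconv (c j t) (fun n => dsym j n * c l t n) m := by
    intro j l m
    rw [mFourierCoeff_mul (hVt j).continuous (hsumV j) ((hVt l).partialDeriv j).continuous]
    have h1 : (fun n => mFourierCoeff (V j t) n) = c j t := funext fun n => hcV j t n
    have h2 : (fun n => mFourierCoeff (FunctionSpaces.Torus.partialDeriv j (V l t)) n) =
        fun n => dsym j n * c l t n :=
      funext fun n => hcVd j l n
    rw [h1, h2]
  have hP2 : ∀ j l m, mFourierCoeff (fun x => compC u j t x * FunctionSpaces.Torus.partialDeriv j (V l t) x) m =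
      lconv (U j t) (fun n => dsym j n * c l t n) m := by
    intro j l m
    rw [mFourierCoeff_mul (hcompCt j).continuous (summable_norm_mFourierCoeff (hcompCt j))
      ((hVt l).partialDeriv j).continuous]
    have h1 : (fun n => mFourierCoeff (compC u j t) n) = U j t := funext fun n => hcU j n
    have h2 : (fun n => mFourierCoeff (FunctionSpaces.Torus.partialDeriv j (V l t)) n) =
        fun n => dsym j n * c l t n :=
      funext fun n => hcVd j l n
    rw [h1, h2]
  have hP3 : ∀ j l m, mFourierCoeff (fun x => V j t x * FunctionSpaces.Torus.partialDeriv j (compC u l t) x) m =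
      lconv (c j t) (fun n => dsym j n * U l t n) m := by
    intro j l m
    rw [mFourierCoeff_mul (hVt j).continuous (hsumV j) ((hcompCt l).partialDeriv j).continuous]
    have h1 : (fun n => mFourierCoeff (V j t) n) = c j t := funext fun n => hcV j t n
    have h2 : (fun n => mFourierCoeff (FunctionSpaces.Torus.partialDeriv j (compC u l t)) n) =
        fun n => dsym j n * U l t n :=
      funext fun n => hcUd j l n
    rw [h1, h2]
  -- the four terms as functions
  set T1 : UnitAddTorus d → ℂ := FunctionSpaces.Torus.timeDerivWithin (Icc 0 θ) (V l) t with hT1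
  set T2 : UnitAddTorus d → ℂ := fun x => ∑ j, (V j t x * FunctionSpaces.Torus.partialDeriv j (V l t) x +
    compC u j t x * FunctionSpaces.Torus.partialDeriv j (V l t) x +
    V j t x * FunctionSpaces.Torus.partialDeriv j (compC u l t) x) with hT2
  set T3 : UnitAddTorus d → ℂ := FunctionSpaces.Torus.partialDeriv l (Qc t) with hT3
  set T4 : UnitAddTorus d → ℂ := fun x => (ν : ℂ) * FunctionSpaces.Torus.laplacian (V l t) x with hT4
  -- continuity
  have hT1c : Continuous T1 := (((hV l).timeDerivWithin hUS).isSmooth_slice ht).continuous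
  have hprodc : ∀ j, Continuous fun x => V j t x * FunctionSpaces.Torus.partialDeriv j (V l t) x +
      compC u j t x * FunctionSpaces.Torus.partialDeriv j (V l t) x +
      V j t x * FunctionSpaces.Torus.partialDeriv j (compC u l t) x := fun j =>
    (((hVt j).continuous.mul ((hVt l).partialDeriv j).continuous).add
      ((hcompCt j).continuous.mul ((hVt l).partialDeriv j).continuous)).add
      ((hVt j).continuous.mul ((hcompCt l).partialDeriv j).continuous)
  have hT2c : Continuous T2 := continuous_finsetSum _ fun j _ => hprodc j
  have hT3c : Continuous T3 := (hQt.partialDeriv l).continuous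
  have hT4c : Continuous T4 := continuous_const.mul (hVt l).laplacian.continuous
  -- the defect and its coefficients
  have hEc : Continuous fun x => T1 x + T2 x + T3 x - T4 x := ((hT1c.add hT2c).add hT3c).sub hT4c
  have hEcoeff : ∀ m, mFourierCoeff (fun x => T1 x + T2 x + T3 x - T4 x) m = 0 := by
    intro m
    have i1 := hT1c.integrable_unitAddTorus
    have i2 := hT2c.integrable_unitAddTorus
    have i3 := hT3c.integrable_unitAddTorus
    have i4 := hT4c.integrable_unitAddTorus
    change mFourierCoeff (((T1 + T2) + T3) - T4) m = 0
    rw [FunctionSpaces.Torus.mFourierCoeff_sub ((i1.add i2).add i3) i4,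
      FunctionSpaces.Torus.mFourierCoeff_add (i1.add i2) i3,
      FunctionSpaces.Torus.mFourierCoeff_add i1 i2]
    -- the coefficients of the four terms
    have e1 : mFourierCoeff T1 m = -(heatRate ν m : ℂ) * c l t m -
        projSym (fun j => U j t) 0 (fun j => c j t) l m := hcVt l t ht m
    have e2 : mFourierCoeff T2 m = transportSym (fun j => c j t) (c l t) m +
        transportSym (fun j => U j t) (c l t) m + transportSym (fun j => c j t) (U l t) m := by
      rw [hT2, FunctionSpaces.Torus.mFourierCoeff_finset_sum _ fun j _ => (hprodc j).integrable_unitAddTorus,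
        transportSym_apply, transportSym_apply, transportSym_apply, ← Finset.sum_add_distrib,
        ← Finset.sum_add_distrib]
      refine Finset.sum_congr rfl fun j _ => ?_
      have ia : Integrable (fun x => V j t x * FunctionSpaces.Torus.partialDeriv j (V l t) x) volume :=
        ((hVt j).continuous.mul ((hVt l).partialDeriv j).continuous).integrable_unitAddTorus
      have ib : Integrable (fun x => compC u j t x * FunctionSpaces.Torus.partialDeriv j (V l t) x) volume :=
        ((hcompCt j).continuous.mul ((hVt l).partialDeriv j).continuous).integrable_unitAddTorus
      have ic : Integrable (fun x => V j t x * FunctionSpaces.Torus.partialDeriv j (compC u l t) x) volume :=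
        ((hVt j).continuous.mul ((hcompCt l).partialDeriv j).continuous).integrable_unitAddTorus
      change mFourierCoeff (((fun x => V j t x * FunctionSpaces.Torus.partialDeriv j (V l t) x) +
        (fun x => compC u j t x * FunctionSpaces.Torus.partialDeriv j (V l t) x)) +
        (fun x => V j t x * FunctionSpaces.Torus.partialDeriv j (compC u l t) x)) m = _
      rw [FunctionSpaces.Torus.mFourierCoeff_add (ia.add ib) ic, FunctionSpaces.Torus.mFourierCoeff_add ia ib,
        hP1 j l m, hP2 j l m, hP3 j l m]
    have e3 : mFourierCoeff T3 m = dsym l m * presCoeffField ν θ u v₀ t m := hcQd l m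
    have e4 : mFourierCoeff T4 m = (ν : ℂ) * (-((4 * π ^ 2 * freqNormSq m : ℝ) : ℂ) * c l t m) := by
      rw [hT4, Torus.mFourierCoeff_const_mul', hcVΔ l m]
    rw [e1, e2, e3, e4, presCoeffField_apply]
    have hid := projSym_pressure_identity (fun j => U j t) 0 (fun j => c j t) l m
    rw [convSym_apply] at hid
    simp only [Pi.zero_apply, mul_zero, Finset.sum_const_zero, add_zero] at hid
    rw [heatRate_apply]
    push_cast
    linear_combination hid
  -- hence the defect vanishes
  exact Torus.eq_zero_of_forall_mFourierCoeff_eq_zero hEc hEcoeff x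

-- one long verification; the coefficient bookkeeping elaborates slowly
set_option maxHeartbeats 1600000 in
/-- **The synthesized real fields solve the perturbed Navier–Stokes system on `[0, θ] × T^d`.**
Under the threshold hypotheses `BallHyp` (the order-four ball; `PerturbedNSFourierPicard`) for
the data of a background `u` jointly smooth and divergence free on `[0, θ] × T^d` and a smooth
divergence-free mean-zero datum `v₀`, the fields `v = vel ν θ u v₀`, `q = pres ν θ u v₀` are
jointly smooth on `[0, θ] × T^d`, `v(t)` is divergence free and mean zero, `q(t)` is mean
zero, `∂ₜv + (v·∇)v + (u·∇)v + (v·∇)u = νΔv - ∇q` holds pointwise on `[0, θ]` with the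
one-sided time derivative within `[0, θ]`, and `v(0) = v₀` (Cheskidov–Luo 2022, §3.1 (3.2):
the perturbation system around `u`, here with datum and zero stress; Majda–Bertozzi 2002,
Thm. 3.4, for the short-time `H^m` theory; real parts of `momentum_complex`).
[cite: CheskidovLuo2022, §3.1 (3.2) and Prop. 3.2] -/
theorem vel_isSolution (h : BallHyp ν θ (driftCoeff θ u) (datumCoeff v₀) Z ρ A)
    (hu : FunctionSpaces.Torus.IsSmoothSpaceTimeOn (Icc 0 θ) u)
    (hdiv : ∀ t ∈ Icc 0 θ, FunctionSpaces.Torus.IsDivFree (u t)) (hv₀ : IsSmooth v₀)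
    (hv₀div : FunctionSpaces.Torus.IsDivFree v₀) (hv₀mean : FunctionSpaces.Torus.HasZeroMean v₀) :
    FunctionSpaces.Torus.IsSmoothSpaceTimeOn (Icc 0 θ) (vel ν θ u v₀) ∧
    FunctionSpaces.Torus.IsSmoothSpaceTimeOn (Icc 0 θ) (pres ν θ u v₀) ∧
    (∀ t ∈ Icc 0 θ, FunctionSpaces.Torus.IsDivFree (vel ν θ u v₀ t)) ∧
    (∀ t ∈ Icc 0 θ, FunctionSpaces.Torus.HasZeroMean (vel ν θ u v₀ t)) ∧
    (∀ t ∈ Icc 0 θ, FunctionSpaces.Torus.HasZeroMean (pres ν θ u v₀ t)) ∧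
    (∀ t ∈ Icc 0 θ, ∀ x, FunctionSpaces.Torus.timeDerivWithin (Icc 0 θ) (vel ν θ u v₀) t x +
        FunctionSpaces.Torus.convect (vel ν θ u v₀ t) (vel ν θ u v₀ t) x +
        FunctionSpaces.Torus.convect (u t) (vel ν θ u v₀ t) x +
        FunctionSpaces.Torus.convect (vel ν θ u v₀ t) (u t) x =
      ν • FunctionSpaces.Torus.laplacian (vel ν θ u v₀ t) x -
        FunctionSpaces.Torus.gradient (pres ν θ u v₀ t) x) ∧
    vel ν θ u v₀ 0 = v₀ := by
  obtain ⟨-, hdecay, hdivF, hzero, -, -, -, -⟩ := solCoeff_spec h hu hdiv hv₀ hv₀div hv₀mean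
  obtain ⟨hV, hQ, hVreal, hQreal, hvel, hpres, hcV, -, hcQ, -, hdatum⟩ :=
    synth_spec h hu hdiv hv₀ hv₀div hv₀mean
  have hθ := h.hθ
  have hUS : UniqueDiffOn ℝ (Icc 0 θ) := uniqueDiffOn_Icc hθ
  set c := solCoeff ν θ u v₀ with hc
  set V := velC ν θ u v₀ with hVdef
  set Qc := presC ν θ u v₀ with hQcdef
  set v := vel ν θ u v₀ with hv
  set q := pres ν θ u v₀ with hq
  -- the complex fields as casts of the real ones (as functions)
  have hVfun : ∀ l, V l = fun s y => ((v s y l : ℝ) : ℂ) := fun l => by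
    funext s y; exact hVreal l s y
  have hQfun : Qc = fun s y => ((q s y : ℝ) : ℂ) := by
    funext s y; exact hQreal s y
  -- smoothness of slices
  have hvt : ∀ t ∈ Icc 0 θ, IsSmooth (v t) := fun t ht => hvel.isSmooth_slice ht
  have hut : ∀ t ∈ Icc 0 θ, IsSmooth (u t) := fun t ht => hu.isSmooth_slice ht
  have hqt : ∀ t ∈ Icc 0 θ, IsSmooth (q t) := fun t ht => hpres.isSmooth_slice ht
  have hVt : ∀ l, ∀ t ∈ Icc 0 θ, IsSmooth (V l t) := fun l t ht => (hV l).isSmooth_slice ht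
  ------------------------------------------------------------------
  -- the real momentum equation, componentwise
  ------------------------------------------------------------------
  have hreal : ∀ l, ∀ t ∈ Icc 0 θ, ∀ x,
      FunctionSpaces.Torus.timeDerivWithin (Icc 0 θ) (fun s y => v s y l) t x +
        (∑ j, (v t x j * FunctionSpaces.Torus.partialDeriv j (fun y => v t y l) x +
          u t x j * FunctionSpaces.Torus.partialDeriv j (fun y => v t y l) x +
          v t x j * FunctionSpaces.Torus.partialDeriv j (fun y => u t y l) x)) +
        FunctionSpaces.Torus.partialDeriv l (q t) x -
        ν * FunctionSpaces.Torus.laplacian (fun y => v t y l) x = 0 := by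
    intro l t ht x
    have h0 := momentum_complex h hu hdiv hv₀ hv₀div hv₀mean l ht x
    rw [← hVdef, ← hQcdef] at h0
    have hvl : FunctionSpaces.Torus.IsSmoothSpaceTimeOn (Icc 0 θ) (fun s y => v s y l) := hvel.apply l
    have hvtl : ∀ j, IsSmooth (fun y => v t y j) := fun j => (hvt t ht).apply j
    have hutl : ∀ j, IsSmooth (fun y => u t y j) := fun j => (hut t ht).apply j
    -- rewrite every complex term as the cast of the real one
    have r1 : FunctionSpaces.Torus.timeDerivWithin (Icc 0 θ) (V l) t x =
        ((FunctionSpaces.Torus.timeDerivWithin (Icc 0 θ) (fun s y => v s y l) t x : ℝ) : ℂ) := by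
      rw [hVfun l]; exact Torus.timeDerivWithin_ofReal hvl hUS ht x
    have r2 : ∀ j, V j t x = ((v t x j : ℝ) : ℂ) := fun j => hVreal j t x
    have r3 : ∀ j, FunctionSpaces.Torus.partialDeriv j (V l t) x =
        ((FunctionSpaces.Torus.partialDeriv j (fun y => v t y l) x : ℝ) : ℂ) := by
      intro j
      have : V l t = fun y => ((v t y l : ℝ) : ℂ) := by rw [hVfun l]
      rw [this]; exact Torus.partialDeriv_ofReal (hvtl l) j x
    have r4 : ∀ j, compC u j t x = ((u t x j : ℝ) : ℂ) := fun j => rfl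
    have r5 : ∀ j, FunctionSpaces.Torus.partialDeriv j (compC u l t) x =
        ((FunctionSpaces.Torus.partialDeriv j (fun y => u t y l) x : ℝ) : ℂ) :=
      fun j => Torus.partialDeriv_ofReal (hutl l) j x
    have r6 : FunctionSpaces.Torus.partialDeriv l (Qc t) x =
        ((FunctionSpaces.Torus.partialDeriv l (q t) x : ℝ) : ℂ) := by
      have : Qc t = fun y => ((q t y : ℝ) : ℂ) := by rw [hQfun]
      rw [this]; exact Torus.partialDeriv_ofReal (hqt t ht) l x
    have r7 : FunctionSpaces.Torus.laplacian (V l t) x =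
        ((FunctionSpaces.Torus.laplacian (fun y => v t y l) x : ℝ) : ℂ) := by
      have : V l t = fun y => ((v t y l : ℝ) : ℂ) := by rw [hVfun l]
      rw [this]; exact Torus.laplacian_ofReal (hvtl l) x
    simp only [r1, r2, r3, r4, r5, r6, r7, ← Complex.ofReal_mul, ← Complex.ofReal_add, ← Complex.ofReal_sub,
      ← Complex.ofReal_sum, Complex.ofReal_eq_zero] at h0
    exact h0
  ------------------------------------------------------------------
  -- the clauses
  ------------------------------------------------------------------
  refine ⟨hvel, hpres, fun t ht x => ?_, fun t ht => ?_, fun t ht => ?_, fun t ht x => ?_, hdatum⟩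
  · -- incompressibility
    have hvs : IsSmooth (v t) := hvt t ht
    rw [FunctionSpaces.Torus.divergence]
    have hDc : Continuous fun y => ∑ l, FunctionSpaces.Torus.partialDeriv l (V l t) y :=
      continuous_finsetSum _ fun l _ => ((hVt l t ht).partialDeriv l).continuous
    have hDcoeff : ∀ m, mFourierCoeff (fun y => ∑ l, FunctionSpaces.Torus.partialDeriv l (V l t) y) m = 0 := by
      intro m
      rw [FunctionSpaces.Torus.mFourierCoeff_finset_sum _ fun l _ =>
        ((hVt l t ht).partialDeriv l).continuous.integrable_unitAddTorus]
      have hcVd : ∀ l, mFourierCoeff (FunctionSpaces.Torus.partialDeriv l (V l t)) m = dsym l m * c l t m :=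
          fun l => by
        rw [FunctionSpaces.Torus.mFourierCoeff_partialDeriv (hVt l t ht) l m, hcV, dsym_apply, smul_eq_mul]
      simp_rw [hcVd]
      exact sum_dsym_mul_eq_zero (c := fun l => c l t) (fun m => hdivF t m) m
    have hD0 := Torus.eq_zero_of_forall_mFourierCoeff_eq_zero hDc hDcoeff x
    have hcast : ∑ l, FunctionSpaces.Torus.partialDeriv l (V l t) x =
        ((∑ l, FunctionSpaces.Torus.partialDeriv l (fun y => v t y l) x : ℝ) : ℂ) := by
      rw [Complex.ofReal_sum]
      refine Finset.sum_congr rfl fun l _ => ?_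
      have : V l t = fun y => ((v t y l : ℝ) : ℂ) := by rw [hVfun l]
      rw [this]; exact Torus.partialDeriv_ofReal (hvs.apply l) l x
    rw [hcast] at hD0
    exact Complex.ofReal_eq_zero.1 hD0
  · -- zero mean of the velocity
    have hvs : IsSmooth (v t) := hvt t ht
    change ∫ x, v t x = 0
    ext l
    have hint : Integrable (v t) volume := hvs.integrable
    rw [show (∫ x, v t x) l = (EuclideanSpace.proj l : EuclideanSpace ℝ d →L[ℝ] ℝ) (∫ x, v t x) from rfl,
      ← ContinuousLinearMap.integral_comp_comm _ hint]
    change ∫ x, v t x l = (0 : EuclideanSpace ℝ d) l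
    have h0 : ((∫ x, v t x l : ℝ) : ℂ) = 0 := by
      rw [← integral_complex_ofReal]
      have : (fun x => ((v t x l : ℝ) : ℂ)) = V l t := by rw [hVfun l]
      rw [this, ← FunctionSpaces.Torus.mFourierCoeff_zero_eq_integral, hcV, hzero l t]
    have : ∫ x, v t x l = 0 := Complex.ofReal_eq_zero.1 h0
    rw [this]; rfl
  · -- zero mean of the pressure
    change ∫ x, q t x = 0
    have h0 : ((∫ x, q t x : ℝ) : ℂ) = 0 := by
      rw [← integral_complex_ofReal]
      have : (fun x => ((q t x : ℝ) : ℂ)) = Qc t := by rw [hQfun]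
      rw [this, ← FunctionSpaces.Torus.mFourierCoeff_zero_eq_integral, hcQ t ht, presCoeffField_apply,
        presCoef_apply]
      simp
    exact Complex.ofReal_eq_zero.1 h0
  · -- momentum, as vectors
    have hvs : IsSmooth (v t) := hvt t ht
    have hus : IsSmooth (u t) := hut t ht
    have hqs : IsSmooth (q t) := hqt t ht
    ext l
    rw [PiLp.sub_apply, PiLp.add_apply, PiLp.add_apply, PiLp.add_apply, PiLp.smul_apply, smul_eq_mul,
      ← Torus.timeDerivWithin_apply_comp hvel hUS ht x l, Torus.convect_apply_eq hvs,
      Torus.convect_apply_eq hvs, Torus.convect_apply_eq hus,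
      FunctionSpaces.Torus.gradient_apply (hqs.isContDiff (by simp)), ← Torus.laplacian_apply_comp hvs]
    have h0 := hreal l t ht x
    rw [Finset.sum_add_distrib, Finset.sum_add_distrib] at h0
    linarith

end PerturbedNSFourier

end Literature.Analysis.FluidPDE

end
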